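import Summits.CriticalPhenomena.PercolationContinuityZ3.Theorems.PercNearOneGluingNoHeavyLowerTailSahiC3CubeEvents
import Summits.CriticalPhenomena.PercolationContinuityZ3.Theorems.PercNearOneGluingNoHeavyLowerTailSahiAbsorbedSaturation
import Summits.CriticalPhenomena.PercolationContinuityZ3.Theorems.SahiConjectureLayerCake

/-!
# Kahn's Conjecture 5 on the cube `{0,1}^m` by COLOURED ANTICHAINS: a kernel-checkable certificate over the saturated triples only

Support file (cell `prim-sahi`, seat `prim-sahi-typer` gen 27; `--supports stmt-CriticalPhenomena-4575`).  No `sorry`; the checker is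
computable and nothing is evaluated here (the evaluations `m = 5` … live in separate, computational files).

`prim-sahi-p1`'s `checkCube m σ` (…`SahiC3CubeCertCheck`) runs the tensor-Bernstein digit test `checkTripleW` over ALL sorted triples of
increasing bitmasks of the `m`-cube (`804 440` at `m = 4`; `≈ 7·10^10` at `m = 5`, out of reach).  By the VALUE-LEVEL SATURATION REDUCTION
(`SahiAbsorbed.sahiPositive_three_of_colouring`, …`SahiAbsorbedSaturation`): Sahi's `C_3` for an FKG weight — here the product weight
`bernoulliWeight p` on `Set (Fin m)` — is decided on the triples CO-GENERATED BY A 3-COLOURED ANTICHAIN, `U_i = {S | ∀ T ∈ N, c T = i → ¬ S ⊆ T}`.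
There are only `Σ_{antichains N} 3^{|N|}` of them: `6 484` (`m = 4`), `4 061 113` (`m = 5`), `1.66·10^12` (`m = 6`).

* `belowN`, `coneN`, `memN`, `downMask` — bitmasks (points of the cube = numbers `x < 2^m`, `x ⊆ t` iff `x &&& t = x`);
* `goCC`, `colourCheck m σ` — the digit test over all 3-coloured antichains, by include/exclude recursion over the points with the
  comparability cone as the exclusion mask (computable; `native_decide`/`decide` targets);
* `goCC_sound`, `checkTriple_of_colourCheck` — completeness of the recursion: every 3-coloured antichain of points is reached;
* `encA_colourMember` — the bitmask of the co-generated member is the checker's mask;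
* **`sahiE3_nonneg_of_colourCheck`**: `colourCheck m σ = true →` for every product measure `prodBernoulli p` on `{0,1}^m` and all increasing
  `A, B, C`, `0 ≤ E₃(A,B,C)` — Kahn's Conjecture 5 / Sahi's `C_3` on the `m`-cube. [this work]
-/

namespace Summit.CriticalPhenomena.PercolationContinuityZ3.Theorems.SahiC3Cube

open Finset MeasureTheory OneCutCert CovTransferCert
open Literature.Combinatorics.Sahi2008
open Literature.Probability.LatticeModels (prodBernoulli sahiE3)
open Literature.Probability.Percolation
open Literature.Probability.Percolation.DecisionTree (ind)

/-! ## Bitmasks of down-closures, cones and members -/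

/-- Bitmask of the points of the `m`-cube lying below the point `t` (`x ⊆ t`, i.e. `x &&& t = x`). [this work] -/
def belowN (m t : ℕ) : ℕ := ofBits (fun x => decide (x &&& t = x)) (2 ^ m)

/-- Bitmask of the points of the `m`-cube comparable with `t` (`x ⊆ t` or `t ⊆ x`). [this work] -/
def coneN (m t : ℕ) : ℕ := ofBits (fun x => decide (x &&& t = x ∨ t &&& x = t)) (2 ^ m)

/-- The member cut out by a down-mask `D`: the points of the cube outside `D`. [this work] -/
def memN (m D : ℕ) : ℕ := ofBits (fun x => !D.testBit x) (2 ^ m)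

/-- Bits of `belowN`. [this work] -/
theorem testBit_belowN (m t x : ℕ) : (belowN m t).testBit x = (decide (x < 2 ^ m) && decide (x &&& t = x)) := by
  unfold belowN; rw [testBit_ofBits]

/-- Bits of `coneN`. [this work] -/
theorem testBit_coneN (m t x : ℕ) :
    (coneN m t).testBit x = (decide (x < 2 ^ m) && decide (x &&& t = x ∨ t &&& x = t)) := by
  unfold coneN; rw [testBit_ofBits]

/-- Bits of `memN`. [this work] -/
theorem testBit_memN (m D x : ℕ) : (memN m D).testBit x = (decide (x < 2 ^ m) && !D.testBit x) := by
  unfold memN; rw [testBit_ofBits]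

/-- The down-mask generated by the points of colour `i` of a coloured point set. [this work] -/
def downMask (m : ℕ) (E : Finset ℕ) (c : ℕ → Fin 3) (i : Fin 3) : ℕ :=
  ofBits (fun x => decide (∃ t ∈ E, c t = i ∧ x &&& t = x)) (2 ^ m)

/-- Bits of `downMask`. [this work] -/
theorem testBit_downMask (m : ℕ) (E : Finset ℕ) (c : ℕ → Fin 3) (i : Fin 3) (x : ℕ) :
    (downMask m E c i).testBit x = (decide (x < 2 ^ m) && decide (∃ t ∈ E, c t = i ∧ x &&& t = x)) := by
  unfold downMask; rw [testBit_ofBits]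

/-- The empty coloured set generates nothing: `memN m (d ||| downMask m ∅ c i) = memN m d`. [this work] -/
theorem memN_lor_downMask_empty (m d : ℕ) (c : ℕ → Fin 3) (i : Fin 3) : memN m (d ||| downMask m ∅ c i) = memN m d := by
  refine Nat.eq_of_testBit_eq fun x => ?_
  simp [testBit_memN, testBit_downMask]

/-- Removing a point of another colour does not change the down-mask of colour `j`. [this work] -/
theorem downMask_erase_of_ne (m : ℕ) (E : Finset ℕ) (c : ℕ → Fin 3) {q : ℕ} {j : Fin 3} (hj : c q ≠ j) :
    downMask m (E.erase q) c j = downMask m E c j := by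
  refine Nat.eq_of_testBit_eq fun x => ?_
  rw [testBit_downMask, testBit_downMask]
  congr 1
  refine Bool.decide_congr ⟨?_, ?_⟩
  · rintro ⟨t, ht, hct, hxt⟩
    exact ⟨t, (mem_erase.1 ht).2, hct, hxt⟩
  · rintro ⟨t, ht, hct, hxt⟩
    refine ⟨t, mem_erase.2 ⟨?_, ht⟩, hct, hxt⟩
    rintro rfl
    exact hj hct

/-- Adding the point `q` of colour `c q` by hand: `d ||| belowN m q ||| downMask (E.erase q) = d ||| downMask E` (colour `c q`). [this work] -/
theorem memN_step (m d : ℕ) (E : Finset ℕ) (c : ℕ → Fin 3) {q : ℕ} (hq : q ∈ E) :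
    memN m (d ||| belowN m q ||| downMask m (E.erase q) c (c q)) = memN m (d ||| downMask m E c (c q)) := by
  refine Nat.eq_of_testBit_eq fun x => ?_
  simp only [testBit_memN, Nat.testBit_lor, testBit_belowN, testBit_downMask]
  by_cases hx : x < 2 ^ m
  · simp only [hx, decide_true, Bool.true_and]
    congr 1
    cases hd : d.testBit x
    · simp only [Bool.false_or]
      rw [← Bool.decide_or]
      refine Bool.decide_congr ⟨?_, ?_⟩
      · rintro (hxq | ⟨t, ht, hct, hxt⟩)
        · exact ⟨q, hq, rfl, hxq⟩
        · exact ⟨t, (mem_erase.1 ht).2, hct, hxt⟩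
      · rintro ⟨t, ht, hct, hxt⟩
        by_cases htq : t = q
        · subst htq; exact Or.inl hxt
        · exact Or.inr ⟨t, mem_erase.2 ⟨htq, ht⟩, hct, hxt⟩
    · simp
  · simp [hx]

/-! ## The checker -/

/-- Include/exclude recursion over the points `q, q+1, …, 2^m − 1` (`fuel` of them left): skip `q`, or — if `q` is incomparable with the
points chosen so far (`forb` = union of their cones) — give it one of the three colours (its down-set joins that colour's down-mask);
at the leaves run the digit test on the three co-generated members. [this work] -/
def goCC (σ m : ℕ) (F off : ℤ) (offN : ℕ) : ℕ → ℕ → ℕ → ℕ → ℕ → ℕ → Bool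
  | 0, _, _, d0, d1, d2 => checkTripleW σ m F off offN (memN m d0) (memN m d1) (memN m d2)
  | fuel + 1, q, forb, d0, d1, d2 =>
      goCC σ m F off offN fuel (q + 1) forb d0 d1 d2 &&
        (forb.testBit q ||
          (goCC σ m F off offN fuel (q + 1) (forb ||| coneN m q) (d0 ||| belowN m q) d1 d2 &&
            goCC σ m F off offN fuel (q + 1) (forb ||| coneN m q) d0 (d1 ||| belowN m q) d2 &&
              goCC σ m F off offN fuel (q + 1) (forb ||| coneN m q) d0 d1 (d2 ||| belowN m q)))

/-- **The coloured-antichain check of the `m`-cube in base `2^σ`**: the coefficient bound of `checkTriple` and the digit test for every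
triple co-generated by a 3-coloured antichain of the cube. [this work] -/
def colourCheck (m σ : ℕ) : Bool :=
  decide (0 < σ) && decide (6 * 8 ^ m < 2 ^ (σ - 1)) &&
    goCC σ m (krT σ m (fullN m)) (offT σ m) (offT σ m).toNat (2 ^ m) 0 0 0 0 0

/-! ## Completeness of the recursion -/

/-- **Soundness of `goCC`**: if the recursion from point `q` with state `(forb, d)` passes, then for every set `E` of points `≥ q` that avoid
`forb` and are pairwise incomparable, and every colouring `c`, the digit test passes on the members co-generated by `d` joined with the
coloured down-sets of `E`. [this work] -/
theorem goCC_sound (σ m : ℕ) (F off : ℤ) (offN : ℕ) (c : ℕ → Fin 3) :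
    ∀ (fuel q forb d0 d1 d2 : ℕ), q + fuel = 2 ^ m → goCC σ m F off offN fuel q forb d0 d1 d2 = true →
      ∀ E : Finset ℕ, (∀ x ∈ E, q ≤ x ∧ x < 2 ^ m) → (∀ x ∈ E, forb.testBit x = false) →
        (∀ x ∈ E, ∀ y ∈ E, x ≠ y → x &&& y ≠ x) →
        checkTripleW σ m F off offN (memN m (d0 ||| downMask m E c 0)) (memN m (d1 ||| downMask m E c 1))
          (memN m (d2 ||| downMask m E c 2)) = true := by
  intro fuel
  induction fuel with
  | zero =>
    intro q forb d0 d1 d2 hq h E hE _ _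
    have hE0 : E = ∅ := by
      refine eq_empty_of_forall_notMem fun x hx => ?_
      have := hE x hx
      omega
    subst hE0
    rw [memN_lor_downMask_empty, memN_lor_downMask_empty, memN_lor_downMask_empty]
    exact h
  | succ fuel ih =>
    intro q forb d0 d1 d2 hq h E hE hforb hanti
    unfold goCC at h
    simp only [Bool.and_eq_true, Bool.or_eq_true] at h
    obtain ⟨hskip, hbranch⟩ := h
    have hq' : q + 1 + fuel = 2 ^ m := by omega
    by_cases hqE : q ∈ E
    · -- include `q` with its colour
      have hfq : forb.testBit q = false := hforb q hqE
      rcases hbranch with hf | ⟨⟨h0, h1⟩, h2⟩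
      · rw [hfq] at hf; exact absurd hf Bool.false_ne_true
      -- hypotheses for `E.erase q` from `q + 1` with the enlarged exclusion mask
      have hE' : ∀ x ∈ E.erase q, q + 1 ≤ x ∧ x < 2 ^ m := by
        intro x hx
        obtain ⟨hxq, hxE⟩ := mem_erase.1 hx
        have := hE x hxE
        omega
      have hforb' : ∀ x ∈ E.erase q, (forb ||| coneN m q).testBit x = false := by
        intro x hx
        obtain ⟨hxq, hxE⟩ := mem_erase.1 hx
        rw [Nat.testBit_lor, hforb x hxE, Bool.false_or, testBit_coneN]
        have h1 : x &&& q ≠ x := hanti x hxE q hqE hxq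
        have h2 : q &&& x ≠ q := hanti q hqE x hxE (Ne.symm hxq)
        simp [h1, h2]
      have hanti' : ∀ x ∈ E.erase q, ∀ y ∈ E.erase q, x ≠ y → x &&& y ≠ x :=
        fun x hx y hy hxy => hanti x (mem_of_mem_erase hx) y (mem_of_mem_erase hy) hxy
      -- the colour of `q` selects the branch
      have hc0 : ∀ j : Fin 3, c q ≠ j → downMask m (E.erase q) c j = downMask m E c j :=
        fun j hj => downMask_erase_of_ne m E c hj
      have h3 : c q = 0 ∨ c q = 1 ∨ c q = 2 := by
        generalize c q = j
        fin_cases j <;> simp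
      rcases h3 with hcq | hcq | hcq
      · have key := ih (q + 1) _ _ _ _ hq' h0 (E.erase q) hE' hforb' hanti'
        have e0 := memN_step m d0 E c hqE
        rw [hcq] at e0
        rw [e0, hc0 1 (by rw [hcq]; decide), hc0 2 (by rw [hcq]; decide)] at key
        exact key
      · have key := ih (q + 1) _ _ _ _ hq' h1 (E.erase q) hE' hforb' hanti'
        have e1 := memN_step m d1 E c hqE
        rw [hcq] at e1
        rw [e1, hc0 0 (by rw [hcq]; decide), hc0 2 (by rw [hcq]; decide)] at key
        exact key
      · have key := ih (q + 1) _ _ _ _ hq' h2 (E.erase q) hE' hforb' hanti'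
        have e2 := memN_step m d2 E c hqE
        rw [hcq] at e2
        rw [e2, hc0 0 (by rw [hcq]; decide), hc0 1 (by rw [hcq]; decide)] at key
        exact key
    · -- skip `q`
      refine ih (q + 1) forb d0 d1 d2 hq' hskip E (fun x hx => ?_) hforb hanti
      have := hE x hx
      have hxq : x ≠ q := fun h => hqE (h ▸ hx)
      omega

/-- **`colourCheck` certifies every triple co-generated by a 3-coloured antichain of points.** [this work] -/
theorem checkTriple_of_colourCheck {m σ : ℕ} (h : colourCheck m σ = true) (E : Finset ℕ) (c : ℕ → Fin 3)
    (hE : ∀ x ∈ E, x < 2 ^ m) (hanti : ∀ x ∈ E, ∀ y ∈ E, x ≠ y → x &&& y ≠ x) :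
    checkTriple σ m (memN m (downMask m E c 0)) (memN m (downMask m E c 1)) (memN m (downMask m E c 2)) = true := by
  unfold colourCheck at h
  simp only [Bool.and_eq_true, decide_eq_true_eq] at h
  obtain ⟨⟨hσ, hbnd⟩, hgo⟩ := h
  have key := goCC_sound σ m (krT σ m (fullN m)) (offT σ m) (offT σ m).toNat c (2 ^ m) 0 0 0 0 0 (by simp) hgo E
    (fun x hx => ⟨Nat.zero_le _, hE x hx⟩) (fun x _ => Nat.zero_testBit x) hanti
  have z : ∀ x : ℕ, 0 ||| x = x := fun x => Nat.eq_of_testBit_eq fun i => by simp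
  rw [z, z, z] at key
  unfold checkTriple
  simp only [Bool.and_eq_true, decide_eq_true_eq]
  exact ⟨⟨hσ, hbnd⟩, key⟩

/-! ## From points-as-numbers to events of `Set (Fin m)` -/

section Events

open Classical

/-- The number of a point `T ⊆ Fin m` of the cube. [this work] -/
noncomputable def encS {m : ℕ} (T : Set (Fin m)) : ℕ := enc2 (fun i => decide (i ∈ T))

/-- `encS T < 2^m`. [this work] -/
theorem encS_lt {m : ℕ} (T : Set (Fin m)) : encS T < 2 ^ m := enc2_lt _

/-- `pt m (encS T) = T`. [this work] -/
theorem pt_encS {m : ℕ} (T : Set (Fin m)) : pt m (encS T) = T := by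
  unfold encS
  rw [pt_enc2]
  ext i
  simp

/-- For numbers `x < 2^m`: `x &&& y = x` iff the point of `x` is contained in the point of `y`. [this work] -/
theorem land_eq_self_iff_pt_subset {m x : ℕ} (y : ℕ) (hx : x < 2 ^ m) : x &&& y = x ↔ pt m x ⊆ pt m y := by
  constructor
  · intro h i hi
    simp only [pt, Set.mem_setOf_eq] at hi ⊢
    have := congrArg (fun n => n.testBit i) h
    simp only [Nat.testBit_land, hi] at this
    simpa using this
  · intro h
    refine Nat.eq_of_testBit_eq fun i => ?_
    rw [Nat.testBit_land]
    cases hxi : x.testBit i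
    · simp
    · have him : i < m := by
        by_contra him
        have : x.testBit i = false := Nat.testBit_lt_two_pow (lt_of_lt_of_le hx (Nat.pow_le_pow_right (by norm_num) (not_lt.1 him)))
        rw [this] at hxi
        exact Bool.false_ne_true hxi
      have hmem : (⟨i, him⟩ : Fin m) ∈ pt m x := by simp [pt, hxi]
      have := h hmem
      simp only [pt, Set.mem_setOf_eq] at this
      simp [this]

/-- **The bitmask of a co-generated member is the checker's mask**: for an antichain `N` of points of the cube with colouring `c`,
`encA m {S | ∀ T ∈ N, c T = i → ¬ S ⊆ T} = memN m (downMask m (N.image encS) (c ∘ pt m) i)`. [this work] -/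
theorem encA_colourMember {m : ℕ} (N : Finset (Set (Fin m))) (c : Set (Fin m) → Fin 3) (i : Fin 3) :
    encA m {S | ∀ T ∈ N, c T = i → ¬ S ⊆ T} = memN m (downMask m (N.image encS) (fun x => c (pt m x)) i) := by
  refine Nat.eq_of_testBit_eq fun x => ?_
  rw [testBit_encA, testBit_memN, testBit_downMask]
  by_cases hx : x < 2 ^ m
  · have hiff : (pt m x ∈ {S : Set (Fin m) | ∀ T ∈ N, c T = i → ¬ S ⊆ T}) ↔
        ¬ (∃ t ∈ N.image encS, c (pt m t) = i ∧ x &&& t = x) := by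
      rw [Set.mem_setOf_eq]
      constructor
      · rintro h ⟨t, ht, hct, hxt⟩
        obtain ⟨T, hT, rfl⟩ := mem_image.1 ht
        rw [pt_encS] at hct
        rw [land_eq_self_iff_pt_subset _ hx, pt_encS] at hxt
        exact h T hT hct hxt
      · intro h T hT hcT hsub
        refine h ⟨encS T, mem_image.2 ⟨T, hT, rfl⟩, ?_, ?_⟩
        · rw [pt_encS]; exact hcT
        · rw [land_eq_self_iff_pt_subset _ hx, pt_encS]; exact hsub
    simp only [hx, decide_true, Bool.true_and]
    by_cases hq : ∃ t ∈ N.image encS, c (pt m t) = i ∧ x &&& t = x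
    · rw [decide_eq_true hq]
      simp only [Bool.not_true, decide_eq_false_iff_not]
      exact fun h => (hiff.1 h) hq
    · rw [decide_eq_false hq]
      simp only [Bool.not_false, decide_eq_true_eq]
      exact hiff.2 hq
  · simp [hx]

/-- **KAHN'S CONJECTURE 5 ON `{0,1}^m` FROM THE COLOURED-ANTICHAIN CHECK.**  If `colourCheck m σ = true` then for every product measure
`prodBernoulli p` (`p : Fin m → [0,1]`) and all increasing events `A, B, C ⊆ Set (Fin m)`: `0 ≤ E₃(A,B,C)`.  (Digit test ⟹ `E₃ ≥ 0` on every
co-generated triple `sahiE3_nonneg_of_checkTriple`; saturation `SahiAbsorbed.sahiPositive_three_of_colouring` for the FKG weight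
`bernoulliWeight p` ⟹ `C_3(μ_p)`; back to events `sahiE3_nonneg_of_sahiPositive_upper`.) [this work] -/
theorem sahiE3_nonneg_of_colourCheck {m σ : ℕ} (h : colourCheck m σ = true) (p : Fin m → unitInterval)
    {A B C : Set (Set (Fin m))} (hA : IsUpperSet A) (hB : IsUpperSet B) (hC : IsUpperSet C) :
    0 ≤ sahiE3 (prodBernoulli p) A B C := by
  refine sahiE3_nonneg_of_sahiPositive_upper p ?_ hA hB hC
  refine SahiAbsorbed.sahiPositive_three_of_colouring (isFKGMeasure_bernoulliWeight p) fun N c hN => ?_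
  -- the co-generated family as events of `Set (Fin m)`
  set U : Fin 3 → Set (Set (Fin m)) := fun i => {S | ∀ T ∈ N, c T = i → ¬ S ⊆ T} with hU
  -- the three bitmasks are the checker's masks for the point set `N.image encS`
  have hE : ∀ x ∈ N.image encS, x < 2 ^ m := by
    intro x hx
    obtain ⟨T, -, rfl⟩ := mem_image.1 hx
    exact encS_lt T
  have hanti : ∀ x ∈ N.image encS, ∀ y ∈ N.image encS, x ≠ y → x &&& y ≠ x := by
    intro x hx y hy hxy hland
    obtain ⟨T, hT, rfl⟩ := mem_image.1 hx
    obtain ⟨T', hT', rfl⟩ := mem_image.1 hy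
    have hsub : T ⊆ T' := by
      have := (land_eq_self_iff_pt_subset (encS T') (encS_lt T)).1 hland
      rwa [pt_encS, pt_encS] at this
    have hne : T ≠ T' := fun h => hxy (by rw [h])
    exact hN (mem_coe.2 hT) (mem_coe.2 hT') hne hsub
  have key := checkTriple_of_colourCheck h (N.image encS) (fun x => c (pt m x)) hE hanti
  rw [← encA_colourMember N c 0, ← encA_colourMember N c 1, ← encA_colourMember N c 2] at key
  have hev : 0 ≤ sahiE3 (prodBernoulli p) (U 0) (U 1) (U 2) := sahiE3_nonneg_of_checkTriple p key
  -- transport to the weight form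
  have hgoal : ∀ G : Fin 3 → Set (Fin m) → ℝ, G = ![ind (U 0), ind (U 1), ind (U 2)] →
      0 ≤ sahiE (bernoulliWeight p) 3 G := by
    rintro G rfl
    rw [sahiE_three_ind]
    exact hev
  apply hgoal
  funext i ω
  fin_cases i <;> simp [setInd_apply, ind, hU]

end Events

end Summit.CriticalPhenomena.PercolationContinuityZ3.Theorems.SahiC3Cube
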